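import Literature.NumberTheory.Automorphic.UnitaryGroupTruncatedTraceClassExpansion
import Literature.NumberTheory.Automorphic.UnitaryGroupTruncatedTraceClassPolynomialHolds
import HarnessLib

/-!
# `J^T(f) = Σ_{𝔬 ∈ S_f} p_𝔬(log T)` with every `deg p_𝔬 ≤ 1`, and `J(f) = Σ_{𝔬 ∈ S_f} p_𝔬(0)` — the closer of
# the T1-qs LAW 3 road for the quasi-split `U(J₃)` of a CM extension

(Rogawski, *Automorphic Representations of Unitary Groups in Three Variables* (1990), §2.1 p. 12 «Each term in
(2.1.1) is a polynomial in `T`» and §2.2 p. 13 «Then (2.1.1) is equal to `Σ J^T_𝔬(f)`»; Arthur, Ann. of Math. 114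
(1981), Prop. 2.3; Shokranian (1992), Thm. (5.7), Rem. (5.8) and §5.2.)

Topic `NumberTheory/Automorphic`; namespace `Literature.NumberTheory.Automorphic.UnitaryGroup`. THEOREMS ONLY over
accepted tree modules: no definition, no named fact, no instance, no notation, no `sorry`. The CLOSER of the T1-qs
LAW 3 road of `Cruxes/H413/Lines/F0_T1InnerFormTraceIdentity.lean` (cell `pub/hodgecm-mathlib`, crux H413): the
coarse expansion ★ (3b) `truncatedTrace_eq_sum_truncatedTraceClass_charpoly_cm` («`J^T(f) = Σ_{𝔬 ∈ S_f} J^T_𝔬(f)`»,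
no hypothesis) composed with the per-class polynomials ★ (3c) `truncatedTraceClassPolynomial_cm` («`J^T_𝔬(f) =
p_𝔬(log T)`, `deg p_𝔬 ≤ 1`», no hypothesis), in the letters of ★ `UnitaryGroupArthurTruncatedTrace`
(`IsTruncatedTracePolynomial`, `truncatedTracePolynomial`, `arthurTrace`; no per-class definition is introduced —
the class polynomials are existentially packaged).

* §1 (generic `F, E, c, N, cl`) `isTruncatedTracePolynomial_sum_of_forall_truncatedTraceClass_eq_eval` — if every
  `J^T_𝔬(f)`, `𝔬 ∈ S`, is computed above a threshold by `P 𝔬 (log T)` and `J^T(f) = Σ_{𝔬 ∈ S} J^T_𝔬(f)` above a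
  threshold, then `Σ_{𝔬 ∈ S} P 𝔬` computes `J^T(f)`; hence (★ `IsTruncatedTracePolynomial.unique`) it IS Arthur's
  polynomial (`truncatedTracePolynomial_eq_sum_of_forall_truncatedTraceClass_eq_eval`) and
  **`J(f) = Σ_{𝔬 ∈ S} P 𝔬 (0)`** (`arthurTrace_eq_sum_eval_zero_of_forall_truncatedTraceClass_eq_eval`).
* §2 (the CM pair `(L⁺, L, complexConj)`, class map `charpoly ∘ adelicVal`, NO hypothesis)
  **`truncatedTrace_eq_sum_eval_classPolynomial_charpoly_cm`** — `∃ S_f` finite, `∃ (p_𝔬)_𝔬` all of degree `≤ 1`,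
  `∃ T₀`, `∀ T > T₀`: `J^T_𝔬(f) = p_𝔬(log T)` for `𝔬 ∈ S_f` and `J^T(f) = Σ_{𝔬 ∈ S_f} p_𝔬(log T)`; and
  **`arthurTrace_eq_sum_classPolynomial_eval_zero_charpoly_cm`** — with the same data, `Σ_{𝔬 ∈ S_f} p_𝔬` is
  Arthur's polynomial of `f` and `J(f) = Σ_{𝔬 ∈ S_f} p_𝔬(0)` (the fine `𝔬`-expansion's constant term — the
  socket the elliptic orbital integrals of LAW 4 fill class by class).

## References

* J. D. Rogawski, *Automorphic Representations of Unitary Groups in Three Variables*, Ann. of Math. Stud. 123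
  (1990), §2.1 (p. 12), §2.2 (p. 13) [Rogawski1990].
* J. Arthur, *The trace formula in invariant form*, Ann. of Math. 114 (1981), Prop. 2.3
  [Arthur1981TraceFormulaInvariantForm].
* S. Shokranian, *The Selberg–Arthur Trace Formula*, LNM 1503 (1992), Thm. (5.7), Rem. (5.8), §5.2
  [Shokranian1992].
-/

set_option autoImplicit false

noncomputable section

open MeasureTheory Measure NumberField NumberField.mixedEmbedding IsDedekindDomain Set Polynomial
open scoped NNReal ENNReal Pointwise MatrixGroups Classical

namespace Literature.NumberTheory.Automorphic

namespace UnitaryGroup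

variable {F E : Type} [Field F] [NumberField F] [Field E] [NumberField E] [Algebra F E]
  {c : E ≃ₐ[F] E} {N : ℕ} {ι : Type*}

/-! ## §1 Summing the class polynomials over a finite set of classes (generic) -/

section Generic

variable [NeZero N] [MeasurableSpace (adelicUnipotent F E c N)]
  {μ : Measure (quasiSplit F E c N).automorphicQuotient}
  {ν : Measure (adelicUnipotent F E c N)} {𝓕 : Set (adelicUnipotent F E c N)}
  {cl : (quasiSplit F E c N).arithmeticSubgroup → ι} {f : (quasiSplit F E c N).Adelic → ℂ}
  {S : Finset ι} {P : ι → ℂ[X]}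

/-- **`Σ_{𝔬 ∈ S} p_𝔬` computes `J^T(f)`**: if for every class `𝔬 ∈ S` the polynomial `P 𝔬` computes `J^T_𝔬(f)`
above a threshold, and `J^T(f) = Σ_{𝔬 ∈ S} J^T_𝔬(f)` above a threshold, then `J^T(f) = (Σ_{𝔬 ∈ S} P 𝔬)(log T)`
above the maximum of the finitely many thresholds. [cite: Rogawski1990, §2.2 (p. 13)]
[cite: Shokranian1992, Thm. (5.7) and Rem. (5.8)] -/
theorem isTruncatedTracePolynomial_sum_of_forall_truncatedTraceClass_eq_eval
    (hP : ∀ i ∈ S, ∃ T₀ : ℝ≥0, ∀ T : ℝ≥0, T₀ < T →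
      truncatedTraceClass μ ν 𝓕 T cl i f = (P i).eval ((Real.log (T : ℝ) : ℝ) : ℂ))
    (hsum : ∃ T₁ : ℝ≥0, ∀ T : ℝ≥0, T₁ < T →
      truncatedTrace μ ν 𝓕 T f = ∑ i ∈ S, truncatedTraceClass μ ν 𝓕 T cl i f) :
    IsTruncatedTracePolynomial μ ν 𝓕 f (∑ i ∈ S, P i) := by
  choose! T₀ hT₀ using hP
  obtain ⟨T₁, hT₁⟩ := hsum
  refine ⟨max T₁ (S.sup T₀), fun T hT => ?_⟩
  rw [hT₁ T (lt_of_le_of_lt (le_max_left _ _) hT), eval_finsetSum]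
  exact Finset.sum_congr rfl fun i hi =>
    hT₀ i hi T (lt_of_le_of_lt ((Finset.le_sup hi).trans (le_max_right _ _)) hT)

/-- **`Σ_{𝔬 ∈ S} p_𝔬` IS Arthur's polynomial of `f`** (by uniqueness ★ `IsTruncatedTracePolynomial.unique`).
[cite: Shokranian1992, Thm. (5.7) and Rem. (5.8)] -/
theorem truncatedTracePolynomial_eq_sum_of_forall_truncatedTraceClass_eq_eval
    (hP : ∀ i ∈ S, ∃ T₀ : ℝ≥0, ∀ T : ℝ≥0, T₀ < T →
      truncatedTraceClass μ ν 𝓕 T cl i f = (P i).eval ((Real.log (T : ℝ) : ℝ) : ℂ))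
    (hsum : ∃ T₁ : ℝ≥0, ∀ T : ℝ≥0, T₁ < T →
      truncatedTrace μ ν 𝓕 T f = ∑ i ∈ S, truncatedTraceClass μ ν 𝓕 T cl i f) :
    truncatedTracePolynomial μ ν 𝓕 f = ∑ i ∈ S, P i :=
  truncatedTracePolynomial_eq (isTruncatedTracePolynomial_sum_of_forall_truncatedTraceClass_eq_eval hP hsum)

/-- **`J(f) = Σ_{𝔬 ∈ S} p_𝔬(0)`** — the constant term of the fine `𝔬`-expansion: Arthur's `J(f)` (the value of his
polynomial at `log T = 0`) is the sum over the live classes of the values at `0` of the class polynomials.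
[cite: Rogawski1990, §2.2 (p. 13)] [cite: Shokranian1992, §5.2] -/
theorem arthurTrace_eq_sum_eval_zero_of_forall_truncatedTraceClass_eq_eval
    (hP : ∀ i ∈ S, ∃ T₀ : ℝ≥0, ∀ T : ℝ≥0, T₀ < T →
      truncatedTraceClass μ ν 𝓕 T cl i f = (P i).eval ((Real.log (T : ℝ) : ℝ) : ℂ))
    (hsum : ∃ T₁ : ℝ≥0, ∀ T : ℝ≥0, T₁ < T →
      truncatedTrace μ ν 𝓕 T f = ∑ i ∈ S, truncatedTraceClass μ ν 𝓕 T cl i f) :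
    arthurTrace μ ν 𝓕 f = ∑ i ∈ S, (P i).eval 0 := by
  rw [arthurTrace_eq_eval (isTruncatedTracePolynomial_sum_of_forall_truncatedTraceClass_eq_eval hP hsum),
    eval_finsetSum]

/-- Degree bookkeeping: if every class polynomial on `S` has degree `≤ 1`, so does their sum.
[cite: Shokranian1992, Thm. (5.7) and Rem. (5.8)] -/
theorem natDegree_sum_le_one_of_forall (hdeg : ∀ i ∈ S, (P i).natDegree ≤ 1) :
    (∑ i ∈ S, P i).natDegree ≤ 1 :=
  natDegree_sum_le_of_forall_le _ _ hdeg

end Generic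

/-! ## §2 The CM closers: `J^T(f) = Σ_{𝔬 ∈ S_f} p_𝔬(log T)` and `J(f) = Σ_{𝔬 ∈ S_f} p_𝔬(0)` -/

/-- **T1-qs LAW 3, closed form at a CM extension `L/L⁺`** (quasi-split `U(J₃)`, class map `charpoly ∘ adelicVal`,
NO hypothesis): for every Haar measure `ν` of `N(𝔸)`, fundamental domain `𝓕` of `N(L⁺)`, automorphic measure `μ`
and test function `f` there are a FINITE set `S_f` of classes, class polynomials `p_𝔬 ∈ ℂ[X]` ALL of degree
`≤ 1`, and a threshold `T₀` with, for all `T > T₀`: `J^T_𝔬(f) = p_𝔬(log T)` for every `𝔬 ∈ S_f`, and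
**`J^T(f) = Σ_{𝔬 ∈ S_f} p_𝔬(log T)`**. (★ (3b) `truncatedTrace_eq_sum_truncatedTraceClass_charpoly_cm` ∘ ★ (3c)
`truncatedTraceClassPolynomial_cm`, thresholds maxed over `S_f`.) [cite: Rogawski1990, §2.2 (p. 13)]
[cite: Arthur1981TraceFormulaInvariantForm, Prop. 2.3] [cite: Shokranian1992, Thm. (5.7) and Rem. (5.8)] -/
theorem truncatedTrace_eq_sum_eval_classPolynomial_charpoly_cm (L : Type) [Field L] [NumberField L] [IsCMField L] :
    ∀ [MeasurableSpace (adelicUnipotent (↥(maximalRealSubfield L)) L (IsCMField.complexConj L) 3)]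
      [BorelSpace (adelicUnipotent (↥(maximalRealSubfield L)) L (IsCMField.complexConj L) 3)]
      (ν : Measure (adelicUnipotent (↥(maximalRealSubfield L)) L (IsCMField.complexConj L) 3)) [ν.IsHaarMeasure]
      (𝓕 : Set (adelicUnipotent (↥(maximalRealSubfield L)) L (IsCMField.complexConj L) 3)),
      IsFundamentalDomain (rationalUnipotent (↥(maximalRealSubfield L)) L (IsCMField.complexConj L) 3) 𝓕 ν →
        ∀ (μ : Measure (quasiSplit (↥(maximalRealSubfield L)) L (IsCMField.complexConj L) 3).automorphicQuotient)
          [(quasiSplit (↥(maximalRealSubfield L)) L (IsCMField.complexConj L) 3).IsAutomorphicMeasure μ]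
          (f : (quasiSplit (↥(maximalRealSubfield L)) L (IsCMField.complexConj L) 3).Adelic → ℂ),
          IsQuasiSplitTest (↥(maximalRealSubfield L)) L (IsCMField.complexConj L) 3 f →
          ∃ S : Finset (AdeleRing (𝓞 L) L)[X], ∃ P : (AdeleRing (𝓞 L) L)[X] → ℂ[X],
            (∀ i, (P i).natDegree ≤ 1) ∧ ∃ T₀ : ℝ≥0, ∀ T : ℝ≥0, T₀ < T →
              (∀ i ∈ S, truncatedTraceClass μ ν 𝓕 T
                (fun γ : ↥(quasiSplit (↥(maximalRealSubfield L)) L (IsCMField.complexConj L) 3).arithmeticSubgroup =>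
                  ((adelicVal (↥(maximalRealSubfield L)) L (IsCMField.complexConj L) 3 _ (γ : (quasiSplit (↥(maximalRealSubfield L)) L (IsCMField.complexConj L) 3).Adelic) :
                    GL (Fin 3) (AdeleRing (𝓞 L) L)) : Matrix (Fin 3) (Fin 3) (AdeleRing (𝓞 L) L)).charpoly) i f =
                  (P i).eval ((Real.log (T : ℝ) : ℝ) : ℂ)) ∧
              truncatedTrace μ ν 𝓕 T f = ∑ i ∈ S, (P i).eval ((Real.log (T : ℝ) : ℝ) : ℂ) := by
  intro mN bN ν hν 𝓕 h𝓕 μ hμ f hf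
  obtain ⟨S, T₁, hT₁⟩ := truncatedTrace_eq_sum_truncatedTraceClass_charpoly_cm L ν 𝓕 h𝓕 μ f hf
  have hP := fun i => truncatedTraceClassPolynomial_cm L
    (isConjInvariant_charpoly_adelicVal (F := ↥(maximalRealSubfield L)) (E := L) (c := IsCMField.complexConj L) (N := 3))
    (isUnipotentInvariantOnBorel_charpoly_adelicVal (F := ↥(maximalRealSubfield L)) (E := L) (c := IsCMField.complexConj L) (N := 3))
    i ν 𝓕 h𝓕 μ f hf
  choose P hPdeg T₀ hT₀ using hP
  refine ⟨S, P, hPdeg, max T₁ (S.sup T₀), fun T hT => ?_⟩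
  have h1 : ∀ i ∈ S, truncatedTraceClass μ ν 𝓕 T
      (fun γ : ↥(quasiSplit (↥(maximalRealSubfield L)) L (IsCMField.complexConj L) 3).arithmeticSubgroup =>
        ((adelicVal (↥(maximalRealSubfield L)) L (IsCMField.complexConj L) 3 _ (γ : (quasiSplit (↥(maximalRealSubfield L)) L (IsCMField.complexConj L) 3).Adelic) :
          GL (Fin 3) (AdeleRing (𝓞 L) L)) : Matrix (Fin 3) (Fin 3) (AdeleRing (𝓞 L) L)).charpoly) i f =
        (P i).eval ((Real.log (T : ℝ) : ℝ) : ℂ) :=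
    fun i hi => hT₀ i T (lt_of_le_of_lt ((Finset.le_sup hi).trans (le_max_right _ _)) hT)
  refine ⟨h1, ?_⟩
  rw [(hT₁ T (lt_of_le_of_lt (le_max_left _ _) hT)).2.2]
  exact Finset.sum_congr rfl h1

/-- **T1-qs LAW 3, constant term at a CM extension `L/L⁺`** (NO hypothesis): with `S_f` and the class polynomials
`p_𝔬` (all of degree `≤ 1`, each computing `J^T_𝔬(f)` above a threshold) as above, `Σ_{𝔬 ∈ S_f} p_𝔬` computes
`J^T(f)`, it IS Arthur's polynomial `truncatedTracePolynomial μ ν 𝓕 f` (degree `≤ 1`), and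
**`J(f) = arthurTrace μ ν 𝓕 f = Σ_{𝔬 ∈ S_f} p_𝔬(0)`**. [cite: Rogawski1990, §2.2 (p. 13)]
[cite: Arthur1981TraceFormulaInvariantForm, Prop. 2.3] [cite: Shokranian1992, §5.2] -/
theorem arthurTrace_eq_sum_classPolynomial_eval_zero_charpoly_cm (L : Type) [Field L] [NumberField L]
    [IsCMField L] :
    ∀ [MeasurableSpace (adelicUnipotent (↥(maximalRealSubfield L)) L (IsCMField.complexConj L) 3)]
      [BorelSpace (adelicUnipotent (↥(maximalRealSubfield L)) L (IsCMField.complexConj L) 3)]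
      (ν : Measure (adelicUnipotent (↥(maximalRealSubfield L)) L (IsCMField.complexConj L) 3)) [ν.IsHaarMeasure]
      (𝓕 : Set (adelicUnipotent (↥(maximalRealSubfield L)) L (IsCMField.complexConj L) 3)),
      IsFundamentalDomain (rationalUnipotent (↥(maximalRealSubfield L)) L (IsCMField.complexConj L) 3) 𝓕 ν →
        ∀ (μ : Measure (quasiSplit (↥(maximalRealSubfield L)) L (IsCMField.complexConj L) 3).automorphicQuotient)
          [(quasiSplit (↥(maximalRealSubfield L)) L (IsCMField.complexConj L) 3).IsAutomorphicMeasure μ]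
          (f : (quasiSplit (↥(maximalRealSubfield L)) L (IsCMField.complexConj L) 3).Adelic → ℂ),
          IsQuasiSplitTest (↥(maximalRealSubfield L)) L (IsCMField.complexConj L) 3 f →
          ∃ S : Finset (AdeleRing (𝓞 L) L)[X], ∃ P : (AdeleRing (𝓞 L) L)[X] → ℂ[X],
            (∀ i, (P i).natDegree ≤ 1) ∧
            (∀ i ∈ S, ∃ T₀ : ℝ≥0, ∀ T : ℝ≥0, T₀ < T → truncatedTraceClass μ ν 𝓕 T
                (fun γ : ↥(quasiSplit (↥(maximalRealSubfield L)) L (IsCMField.complexConj L) 3).arithmeticSubgroup =>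
                  ((adelicVal (↥(maximalRealSubfield L)) L (IsCMField.complexConj L) 3 _ (γ : (quasiSplit (↥(maximalRealSubfield L)) L (IsCMField.complexConj L) 3).Adelic) :
                    GL (Fin 3) (AdeleRing (𝓞 L) L)) : Matrix (Fin 3) (Fin 3) (AdeleRing (𝓞 L) L)).charpoly) i f =
                  (P i).eval ((Real.log (T : ℝ) : ℝ) : ℂ)) ∧
            IsTruncatedTracePolynomial μ ν 𝓕 f (∑ i ∈ S, P i) ∧
            (∑ i ∈ S, P i).natDegree ≤ 1 ∧
            truncatedTracePolynomial μ ν 𝓕 f = ∑ i ∈ S, P i ∧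
            arthurTrace μ ν 𝓕 f = ∑ i ∈ S, (P i).eval 0 := by
  intro mN bN ν hν 𝓕 h𝓕 μ hμ f hf
  obtain ⟨S, P, hPdeg, T₀, hT₀⟩ := truncatedTrace_eq_sum_eval_classPolynomial_charpoly_cm L ν 𝓕 h𝓕 μ f hf
  -- `Σ_{𝔬 ∈ S} P 𝔬` computes `J^T(f)` directly from §2's closed form
  have hpoly : IsTruncatedTracePolynomial μ ν 𝓕 f (∑ i ∈ S, P i) :=
    ⟨T₀, fun T hT => by rw [(hT₀ T hT).2, eval_finsetSum]⟩
  exact ⟨S, P, hPdeg, fun i hi => ⟨T₀, fun T hT => (hT₀ T hT).1 i hi⟩, hpoly,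
    natDegree_sum_le_of_forall_le _ _ fun i _ => hPdeg i, truncatedTracePolynomial_eq hpoly,
    by rw [arthurTrace_eq_eval hpoly, eval_finsetSum]⟩

end UnitaryGroup

end Literature.NumberTheory.Automorphic
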